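import Mathlib
import HarnessLib
import Summits.ResolutionOfSingularities.ResolutionOfSingularities.Theorems.WildQuotientsWildQuotientResolutionJordanFiveWSide
import Summits.ResolutionOfSingularities.ResolutionOfSingularities.Theorems.WildQuotientsWildQuotientResolutionJordanFiveChartW2Defs
import Summits.ResolutionOfSingularities.ResolutionOfSingularities.Theorems.WildQuotientsWildQuotientResolutionJordanFiveTwistedChart

/-!
# RUNG V5 (`J₅`), W-side at `W₂ = chartW₂ = D₊(i₂³t · (2j₃)²t)`: `HW₂st` and the seam
(crux stmt-ResolutionOfSingularities-15640 `WildQuotients.WildQuotientResolution`, line `Sketch`;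
chain w45c RUNG V5 `JordanFive.jordanFive_hasResolution_of_bricks` (res-L1-w45c-lead-1 BRICK LIST
v1 `stubs/J5Bricks.lean` l.105–113 `HW₂st`/`HW₂aff`, l.150–163 the `HP₂` binders), res-L1-w45c-plan-1
RULING 10:50Z «stub-5 = (δ1) W-SIDE PACKAGE», W₂ DESIGN = res-L1-w45c-idea-2 (W2-DESIGN.md
400ebbeeb3422d46), W₂ TERM OF RECORD = res-L1-w45c-stub-1's `JordanFive.chartW₂` (p528290,
`…JordanFiveChartW2Defs.lean`); written by res-D-pv-033 AS res-L1-w45c-stub-5. [OURS · L1 W4.5c] —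
assembly of landed decls; NOT a statement of any manuscript.)

* `JordanFive.smul_iTwo`, `JordanFive.smul_jThreeTwo`, `JordanFive.smul_chartW₂_coeff` — every
  `g ∈ ⟨σ⟩` (J₅ law, including `σ x_e = x_e + x_d`) fixes `i₂`, `2j₃` and the coefficient
  `i₂³ · (2j₃)²` of the `W₂` section (stub-1's `JordanFive.map_iTwo` / `map_jThreeTwo`, p522729);
* `JordanFive.preimage_chartW₂_eq` — **`HW₂st` VERBATIM** (J5Bricks l.105–112 at
  `W₂ := chartW₂ k n a b c d e`), for ANY `ρ` with the affine-quotient law and any stability proof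
  `hJρ`, given the `I₁₂`-stability `hI`;
* `JordanFive.exists_sectionsEquiv_chartW₂` — **the SEAM at `W₂`** for the `HP₂` binders
  `(ρ hρ ρB haut O₂ hO₂)`: `φ`, `hP`,
  `Ω : (k[x][I₁₂t])_{(i₂³t·(2j₃)²t)} ≃+* Γ(↥O₂.1, (O₂.1.ι ≫ π ≫ q)⁻¹ ⊤)` with (o) (i) (ii) (iii) — so
  `brickHP2` (res-type-036) reduces to algebra on idea-2's cover `U₂ = {2î + ĵ = 0}`.
`HW₂aff` is stub-1's `isAffineOpen_chartW₂` (not restated).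
-/

-- single-problem summit: the doubled namespace component `ResolutionOfSingularities` is forced
set_option linter.dupNamespace false

noncomputable section

open CategoryTheory AlgebraicGeometry TopologicalSpace MvPolynomial Polynomial HomogeneousLocalization
open Literature.AlgebraicGeometry.Resolution Literature.AlgebraicGeometry.RelativeSpec
open scoped Pointwise

namespace Summit.ResolutionOfSingularities.ResolutionOfSingularities.Theorems.WildQuotientResolution.JordanFive

variable (k : Type) [Field k] (n : ℕ) (σ : MvPolynomial (Fin n) k ≃ₐ[k] MvPolynomial (Fin n) k)
  (a b c d e : Fin n) (hab : a ≠ b) (hac : a ≠ c) (had : a ≠ d) (hae : a ≠ e)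
  (hb : σ (X b) = X b + X a) (hc : σ (X c) = X c + X b) (hd : σ (X d) = X d + X c)
  (he : σ (X e) = X e + X d)
  (hσ : ∀ i, i ≠ b → i ≠ c → i ≠ d → i ≠ e → σ (X i) = X i)

/-- `k[x] → Γ(Spec k[x], ⊤)` (local shorthand) -/
local notation3 "ι₀" => (Scheme.ΓSpecIso (CommRingCat.of (MvPolynomial (Fin n) k))).inv.hom
/-- the quotient map `q : 𝔸ⁿ → 𝔸ⁿ/⟨σ⟩` (local shorthand) -/
local notation3 "qσ" => Spec.map (CommRingCat.ofHom (algebraMap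
  (FixedPoints.subalgebra k (MvPolynomial (Fin n) k) (Subgroup.zpowers σ)) (MvPolynomial (Fin n) k)))

/-! ## Invariance of `i₂`, `2j₃` under `⟨σ⟩` (J₅ law) -/

include hab hac had hae hb hc hd he hσ in
/-- Every `g ∈ ⟨σ⟩` fixes `i₂` (J₅ law). [OURS · L1 W4.5c] [folklore] -/
theorem smul_iTwo (g : ↥(Subgroup.zpowers σ)) :
    g • iTwo k n a b c d e = iTwo k n a b c d e := by
  have hσ' : σ • iTwo k n a b c d e = iTwo k n a b c d e :=
    map_iTwo k n a b c d e (σ : MvPolynomial (Fin n) k →ₐ[k] MvPolynomial (Fin n) k)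
      (hσ a hab hac had hae) hb hc hd he
  obtain ⟨z, hz⟩ := Subgroup.mem_zpowers_iff.mp g.2
  change (g : MvPolynomial (Fin n) k ≃ₐ[k] MvPolynomial (Fin n) k) • iTwo k n a b c d e = _
  rw [← hz]
  exact MulAction.fixedBy_subset_fixedBy_zpow (MvPolynomial (Fin n) k) σ z hσ'

include hab hac had hae hb hc hd he hσ in
/-- Every `g ∈ ⟨σ⟩` fixes `2j₃` (J₅ law). [OURS · L1 W4.5c] [folklore] -/
theorem smul_jThreeTwo (g : ↥(Subgroup.zpowers σ)) :
    g • jThreeTwo k n a b c d e = jThreeTwo k n a b c d e := by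
  have hσ' : σ • jThreeTwo k n a b c d e = jThreeTwo k n a b c d e :=
    map_jThreeTwo k n a b c d e (σ : MvPolynomial (Fin n) k →ₐ[k] MvPolynomial (Fin n) k)
      (hσ a hab hac had hae) hb hc hd he
  obtain ⟨z, hz⟩ := Subgroup.mem_zpowers_iff.mp g.2
  change (g : MvPolynomial (Fin n) k ≃ₐ[k] MvPolynomial (Fin n) k) • jThreeTwo k n a b c d e = _
  rw [← hz]
  exact MulAction.fixedBy_subset_fixedBy_zpow (MvPolynomial (Fin n) k) σ z hσ'

include hab hac had hae hb hc hd he hσ in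
/-- Every `g ∈ ⟨σ⟩` fixes the coefficient `i₂³ · (2j₃)²` of the `W₂` section. [OURS · L1 W4.5c]
[folklore] -/
theorem smul_chartW₂_coeff (g : ↥(Subgroup.zpowers σ)) :
    g • (iTwo k n a b c d e ^ 3 * jThreeTwo k n a b c d e ^ 2) =
      iTwo k n a b c d e ^ 3 * jThreeTwo k n a b c d e ^ 2 := by
  rw [smul_mul', smul_pow', smul_pow', smul_iTwo k n σ a b c d e hab hac had hae hb hc hd he hσ,
    smul_jThreeTwo k n σ a b c d e hab hac had hae hb hc hd he hσ]

/-! ## `HW₂st` -/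

include hab hac had hae hb hc hd he hσ in
/-- **Brick `HW₂st` of the J₅ toric exit** (`stubs/J5Bricks.lean` l.105–112 VERBATIM at
`W₂ := chartW₂ k n a b c d e`): the μ₂-HIGH open `chartW₂ = D₊(i₂³t · (2j₃)²t)` is stable under
the lifted action of every `g ∈ ⟨σ⟩`, for ANY `ρ` with the affine-quotient law and any stability
proof `hJρ`, granted the `⟨σ⟩`-stability `hI` of `I₁₂`. [OURS · L1 W4.5c] [folklore; assembly of
landed decls] -/
theorem preimage_chartW₂_eq
    (hI : ∀ g : ↥(Subgroup.zpowers σ), g • I12 k n a b c d = I12 k n a b c d)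
    (ρ : ↥(Subgroup.zpowers σ) →* Aut (Spec (CommRingCat.of (MvPolynomial (Fin n) k))))
    (hρ : ∀ g : ↥(Subgroup.zpowers σ), (ρ g).hom = Spec.map (CommRingCat.ofHom
      ((MulSemiringAction.toRingEquiv (↥(Subgroup.zpowers σ)) (MvPolynomial (Fin n) k) g⁻¹ :
        MvPolynomial (Fin n) k ≃+* MvPolynomial (Fin n) k) :
          MvPolynomial (Fin n) k →+* MvPolynomial (Fin n) k)))
    (hJρ : ∀ g : ↥(Subgroup.zpowers σ),
      (affineBlowup.idealSheaf (I12 k n a b c d)).comap (ρ g).hom =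
        affineBlowup.idealSheaf (I12 k n a b c d))
    (g : ↥(Subgroup.zpowers σ)) :
    (((affineBlowup.isBlowup (I12 k n a b c d)).liftAction ρ hJρ) g).hom ⁻¹ᵁ chartW₂ k n a b c d e =
      chartW₂ k n a b c d e := by
  rw [chartW₂_def]
  exact preimage_basicOpen_liftAction_I12 k n σ a b c d hI _ (coe_chartW₂_section k n a b c d e)
    (smul_chartW₂_coeff k n σ a b c d e hab hac had hae hb hc hd he hσ) ρ hρ hJρ g

/-! ## The seam at `W₂` -/

include hab hac had hae hb hc hd he hσ in
-- the `ActionOver` binder terms are large: head-room for the statement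
set_option maxHeartbeats 4000000 in
/-- **THE SEAM at `W₂ = chartW₂`** for the binders `(ρ hρ ρB haut O₂ hO₂)` of `HP₂`
(`stubs/J5Bricks.lean` l.150–163): the `φ`-family, its powers clause, and
`Ω : (k[x][I₁₂t])_{(i₂³t·(2j₃)²t)} ≃+* Γ(↥O₂.1, (O₂.1.ι ≫ π ≫ q)⁻¹ ⊤)` with (o) the coefficient law,
(i) `Ω (f/1) = (O₂.1.ι ≫ π)^* f`, (ii) `act g (Ω y) = Ω (φ_{g⁻¹} y)`, (iii)
`Ω y ∈ invariantsRing ⊤ ↔ ∀ g, φ_g y = y`. [OURS · L1 W4.5c] [folklore; assembly of landed decls] -/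
theorem exists_sectionsEquiv_chartW₂
    (hI : ∀ g : ↥(Subgroup.zpowers σ), g • I12 k n a b c d = I12 k n a b c d)
    (ρ : ↥(Subgroup.zpowers σ) →* Aut (Spec (CommRingCat.of (MvPolynomial (Fin n) k))))
    (hρ : ∀ g : ↥(Subgroup.zpowers σ), (ρ g).hom = Spec.map (CommRingCat.ofHom
      ((MulSemiringAction.toRingEquiv (↥(Subgroup.zpowers σ)) (MvPolynomial (Fin n) k) g⁻¹ :
        MvPolynomial (Fin n) k ≃+* MvPolynomial (Fin n) k) :
          MvPolynomial (Fin n) k →+* MvPolynomial (Fin n) k)))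
    (hJρ : ∀ g : ↥(Subgroup.zpowers σ),
      (affineBlowup.idealSheaf (I12 k n a b c d)).comap (ρ g).hom =
        affineBlowup.idealSheaf (I12 k n a b c d))
    (ρB : ActionOver (affineBlowup.π (I12 k n a b c d) ≫ qσ) ↥(Subgroup.zpowers σ))
    (haut : ρB.aut = (affineBlowup.isBlowup (I12 k n a b c d)).liftAction ρ hJρ)
    (O₂ : ρB.StableAffineOpens) (hO₂ : O₂.1 = chartW₂ k n a b c d e) :
    ∃ (φ : ↥(Subgroup.zpowers σ) → (reesGrading (I12 k n a b c d) →+*ᵍ reesGrading (I12 k n a b c d)))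
      (hP : ∀ g, Submonoid.powers (reesT (iTwo k n a b c d e ^ 3) (iTwo_cube_mem_I12 k n a b c d e) *
          reesT (jThreeTwo k n a b c d e ^ 2) (jThreeTwo_sq_mem_I12 k n a b c d e)) ≤
        (Submonoid.powers (reesT (iTwo k n a b c d e ^ 3) (iTwo_cube_mem_I12 k n a b c d e) *
          reesT (jThreeTwo k n a b c d e ^ 2) (jThreeTwo_sq_mem_I12 k n a b c d e))).comap (φ g))
      (Ω : HomogeneousLocalization.Away (reesGrading (I12 k n a b c d))
          (reesT (iTwo k n a b c d e ^ 3) (iTwo_cube_mem_I12 k n a b c d e) *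
            reesT (jThreeTwo k n a b c d e ^ 2) (jThreeTwo_sq_mem_I12 k n a b c d e)) ≃+*
        Γ((O₂.1 : Scheme.{0}), (O₂.1.ι ≫ affineBlowup.π (I12 k n a b c d) ≫ qσ) ⁻¹ᵁ ⊤)),
      (∀ (g : ↥(Subgroup.zpowers σ)) x, ((φ g x : reesAlgebra (I12 k n a b c d)) :
          (MvPolynomial (Fin n) k)[X]) =
        (x : (MvPolynomial (Fin n) k)[X]).map ((MulSemiringAction.toRingEquiv
          (↥(Subgroup.zpowers σ)) (MvPolynomial (Fin n) k) g⁻¹ : _ ≃+* _) : _ →+* _)) ∧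
      (∀ f : MvPolynomial (Fin n) k,
        Ω (((fromZeroRingHom (reesGrading (I12 k n a b c d)) (.powers _)).comp
          (reesGrading.zeroRingHom (I12 k n a b c d))) f) =
        (O₂.1.ι ≫ affineBlowup.π (I12 k n a b c d)).appLE ⊤
          ((O₂.1.ι ≫ affineBlowup.π (I12 k n a b c d) ≫ qσ) ⁻¹ᵁ ⊤) le_top (ι₀ f)) ∧
      (∀ (g : ↥(Subgroup.zpowers σ)) y, (ρB.restrict O₂.1 O₂.2.1).act g ⊤ (Ω y) =
        Ω (HomogeneousLocalization.map (φ g⁻¹) (hP g⁻¹) y)) ∧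
      (∀ y, Ω y ∈ (ρB.restrict O₂.1 O₂.2.1).invariantsRing ⊤ ↔
        ∀ g, HomogeneousLocalization.map (φ g) (hP g) y = y) :=
  exists_sectionsEquiv_basicOpen_I12 k n σ a b c d hI _ (chartW₂_section_mem k n a b c d e)
    (by norm_num) (coe_chartW₂_section k n a b c d e)
    (smul_chartW₂_coeff k n σ a b c d e hab hac had hae hb hc hd he hσ) ρ hρ hJρ ρB haut O₂
    (hO₂.trans (chartW₂_def k n a b c d e))

end Summit.ResolutionOfSingularities.ResolutionOfSingularities.Theorems.WildQuotientResolution.JordanFive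

end
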